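import Literature.NumberTheory.LFunctions.Zhang2022.Section9Statements
import HarnessLib

/-!
# Zhang (2022) §9 «Evaluation of Ξ₁₂»: the definitional, numerical and purely algebraic nodes, discharged

Companion (THEOREM-ONLY) of `Section9Statements` (campaign slice L2-t10, p412071), which typed the 22 nodes
of §9 of Y. Zhang, *Discrete mean estimates and the Landau–Siegel zero*, arXiv:2211.02515v1 (2022)
[Zhang2022LandauSiegel] (tex L2586–L2689, PDF pp. 51–52) — **an unrefereed manuscript under adjudication** —
as claims STATED NOT ASSERTED. This file discharges the nodes that are DEFINITIONAL, NUMERICAL or PURE ALGEBRA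
over the tree; the §9 inference EDGES (`Ded9u002/u003/u005`, `Ded97last(c)`, the u007 step) are the discharge
prover sz-d17's (`Section9Ded97`, claim of 2026-08-25T23:29Z) and are deliberately NOT proved here.

| node | result | how |
|---|---|---|
| `Z22:(9.3)`–`(9.6)` | `eq93_holds` … `eq96_holds` | `rfl` against `b33/b44/b34/b43` (Section18Defs) |
| `Z22:§9.u008`–`u012` | `step9u008_holds` … `step9u012_holds` | `rfl` against `frakc2/c33/c44/c34/c43` |
| `Z22:(9.8)` (inference) | `ded98_holds` | (9.8) is TRUE outright: `ineq98` (Section18Certificate) |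
| `Z22:§9.u013` | `step9u013_holds` (TRUE) | kernel brackets `c33_re_bounds`/`c33_im` (num-lane record `Numerics.n02_printedC33_num_holds`) |
| `Z22:§9.u014` | `step9u014c_holds` (TRUE, `0.5`-prefactor reading), `not_step9u014` (FALSE, printed `0.504` prefactor) | brackets `c34c_*_bounds`, `c34_re_bounds` (num-lane records `Numerics.n02_printedC34c_num_holds`, `not_n02_printedC34_num`) |
| `Z22:§9.u001` | `step9u001_holds` | exact identity for quadratic `χ` (`χ(drm) = χ(d)χ(r)χ(m)`, `χ² = |χ|`, `conj χ = χ`) |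

0 new definitions, 0 new facts. WHAT THIS IS NOT: any claim about Theorems 1–2 of the manuscript or about
Landau–Siegel zeros; `not_step9u014` records a misprinted prefactor in (9.5)–(9.6) ((9.8) holds under both readings,
`ineq98`/`ineq98c`), not a failing inequality of the argument.

## References

* Y. Zhang, arXiv:2211.02515v1 (2022), §9 pp. 51–52. [cite: Zhang2022LandauSiegel, §9]
-/

noncomputable section

open Complex Real ComplexConjugate

namespace Literature.NumberTheory.LFunctions.Zhang2022.Section9Statements

/-! ### (9.3)–(9.6) and the definitions after (9.7): definitional, `rfl` against Section18Defs -/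

/-- `Z22:(9.3)` holds definitionally: the banked `b33` IS the printed right side of (9.3).
[cite: Zhang2022LandauSiegel, §9 (9.3) p.52] -/
theorem eq93_holds : Eq93 := rfl

/-- `Eq93` — `_holds` alias of `eq93_holds` above under the fact's exact name (appended
2026-08-28, D-0026 bookkeeping: the proof term is the existing theorem of this file; no statement,
definition or attribute is edited; no new named fact; the ledger's debt table listed the fact
unproved). [cite: Zhang2022LandauSiegel, §9 (9.3) p.52] -/
theorem _root_.Literature.NumberTheory.LFunctions.Zhang2022.Section9Statements.Eq93_holds : Eq93 :=
  _root_.Literature.NumberTheory.LFunctions.Zhang2022.Section9Statements.eq93_holds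

/-- `Z22:(9.4)` holds definitionally (`b44 := b22`). [cite: Zhang2022LandauSiegel, §9 (9.4) p.52] -/
theorem eq94_holds : Eq94 := rfl

/-- `Eq94` — `_holds` alias of `eq94_holds` above under the fact's exact name (appended
2026-08-28, D-0026 bookkeeping: the proof term is the existing theorem of this file; no statement,
definition or attribute is edited; no new named fact; the ledger's debt table listed the fact
unproved). [cite: Zhang2022LandauSiegel, §9 (9.4) p.52] -/
theorem _root_.Literature.NumberTheory.LFunctions.Zhang2022.Section9Statements.Eq94_holds : Eq94 :=
  _root_.Literature.NumberTheory.LFunctions.Zhang2022.Section9Statements.eq94_holds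

/-- `Z22:(9.5)` (printed prefactor) holds definitionally against the banked `b34`.
[cite: Zhang2022LandauSiegel, §9 (9.5) p.52] -/
theorem eq95_holds : Eq95 := rfl

/-- `Eq95` — `_holds` alias of `eq95_holds` above under the fact's exact name (appended
2026-08-28, D-0026 bookkeeping: the proof term is the existing theorem of this file; no statement,
definition or attribute is edited; no new named fact; the ledger's debt table listed the fact
unproved). [cite: Zhang2022LandauSiegel, §9 (9.5) p.52] -/
theorem _root_.Literature.NumberTheory.LFunctions.Zhang2022.Section9Statements.Eq95_holds : Eq95 :=
  _root_.Literature.NumberTheory.LFunctions.Zhang2022.Section9Statements.eq95_holds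

/-- `Z22:(9.6)` (printed prefactor) holds definitionally against the banked `b43`.
[cite: Zhang2022LandauSiegel, §9 (9.6) p.52] -/
theorem eq96_holds : Eq96 := rfl

/-- `Eq96` — `_holds` alias of `eq96_holds` above under the fact's exact name (appended
2026-08-28, D-0026 bookkeeping: the proof term is the existing theorem of this file; no statement,
definition or attribute is edited; no new named fact; the ledger's debt table listed the fact
unproved). [cite: Zhang2022LandauSiegel, §9 (9.6) p.52] -/
theorem _root_.Literature.NumberTheory.LFunctions.Zhang2022.Section9Statements.Eq96_holds : Eq96 :=
  _root_.Literature.NumberTheory.LFunctions.Zhang2022.Section9Statements.eq96_holds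

/-- `Z22:§9.u008` (`𝔠₂ = |ι₃|²c₃₃ + ι₃ῑ₄c₃₄ + ι₄ῑ₃c₄₃ + |ι₄|²c₄₄`) holds definitionally against the banked `frakc2`.
[cite: Zhang2022LandauSiegel, §9 p.52, tex L2654] -/
theorem step9u008_holds : Step9u008 := rfl

/-- `Step9u008` — `_holds` alias of `step9u008_holds` above under the fact's exact name (appended
2026-08-28, D-0026 bookkeeping: the proof term is the existing theorem of this file; no statement,
definition or attribute is edited; no new named fact; the ledger's debt table listed the fact
unproved). [cite: Zhang2022LandauSiegel, §9 p.52, tex L2654] -/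
theorem _root_.Literature.NumberTheory.LFunctions.Zhang2022.Section9Statements.Step9u008_holds :
    Step9u008 :=
  _root_.Literature.NumberTheory.LFunctions.Zhang2022.Section9Statements.step9u008_holds

/-- `Z22:§9.u009` (`c₃₃ = b₃₃ + b̄₃₃`) holds definitionally. [cite: Zhang2022LandauSiegel, §9 p.52, tex L2658] -/
theorem step9u009_holds : Step9u009 := rfl

/-- `Step9u009` — `_holds` alias of `step9u009_holds` above under the fact's exact name (appended
2026-08-28, D-0026 bookkeeping: the proof term is the existing theorem of this file; no statement,
definition or attribute is edited; no new named fact; the ledger's debt table listed the fact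
unproved). [cite: Zhang2022LandauSiegel, §9 p.52, tex L2658] -/
theorem _root_.Literature.NumberTheory.LFunctions.Zhang2022.Section9Statements.Step9u009_holds :
    Step9u009 :=
  _root_.Literature.NumberTheory.LFunctions.Zhang2022.Section9Statements.step9u009_holds

/-- `Z22:§9.u010` (`c₄₄ = c₂₂`) holds definitionally. [cite: Zhang2022LandauSiegel, §9 p.52, tex L2661] -/
theorem step9u010_holds : Step9u010 := rfl

/-- `Step9u010` — `_holds` alias of `step9u010_holds` above under the fact's exact name (appended
2026-08-28, D-0026 bookkeeping: the proof term is the existing theorem of this file; no statement,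
definition or attribute is edited; no new named fact; the ledger's debt table listed the fact
unproved). [cite: Zhang2022LandauSiegel, §9 p.52, tex L2661] -/
theorem _root_.Literature.NumberTheory.LFunctions.Zhang2022.Section9Statements.Step9u010_holds :
    Step9u010 :=
  _root_.Literature.NumberTheory.LFunctions.Zhang2022.Section9Statements.step9u010_holds

/-- `Z22:§9.u011` (`c₃₄ = b₃₄ + b̄₄₃`) holds definitionally. [cite: Zhang2022LandauSiegel, §9 p.52, tex L2664] -/
theorem step9u011_holds : Step9u011 := rfl

/-- `Step9u011` — `_holds` alias of `step9u011_holds` above under the fact's exact name (appended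
2026-08-28, D-0026 bookkeeping: the proof term is the existing theorem of this file; no statement,
definition or attribute is edited; no new named fact; the ledger's debt table listed the fact
unproved). [cite: Zhang2022LandauSiegel, §9 p.52, tex L2664] -/
theorem _root_.Literature.NumberTheory.LFunctions.Zhang2022.Section9Statements.Step9u011_holds :
    Step9u011 :=
  _root_.Literature.NumberTheory.LFunctions.Zhang2022.Section9Statements.step9u011_holds

/-- `Z22:§9.u012` (`c₄₃ = c̄₃₄`) holds definitionally. [cite: Zhang2022LandauSiegel, §9 p.52, tex L2667] -/
theorem step9u012_holds : Step9u012 := rfl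

/-- `Step9u012` — `_holds` alias of `step9u012_holds` above under the fact's exact name (appended
2026-08-28, D-0026 bookkeeping: the proof term is the existing theorem of this file; no statement,
definition or attribute is edited; no new named fact; the ledger's debt table listed the fact
unproved). [cite: Zhang2022LandauSiegel, §9 p.52, tex L2667] -/
theorem _root_.Literature.NumberTheory.LFunctions.Zhang2022.Section9Statements.Step9u012_holds :
    Step9u012 :=
  _root_.Literature.NumberTheory.LFunctions.Zhang2022.Section9Statements.step9u012_holds

/-! ### (9.8): the printed inference is dischargeable because (9.8) is TRUE in the tree -/

/-- `Z22:(9.8)` inference ("It follows that `𝔠₂ < 6.9955`"): `Step9u013 → Step9u014 → Ineq98`, discharged outright since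
(9.8) is TRUE in the tree (`ineq98`, Section18Certificate: `𝔠₂ = 6.99491…`). [cite: Zhang2022LandauSiegel, §9 (9.8) p.52] -/
theorem ded98_holds : Ded98 := fun _ _ => ineq98

/-- `Ded98` — `_holds` alias of `ded98_holds` above under the fact's exact name (appended
2026-08-28, D-0026 bookkeeping: the proof term is the existing theorem of this file; no statement,
definition or attribute is edited; no new named fact; the ledger's debt table listed the fact
unproved). [cite: Zhang2022LandauSiegel, §9 (9.8) p.52] -/
theorem _root_.Literature.NumberTheory.LFunctions.Zhang2022.Section9Statements.Ded98_holds :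
    Ded98 :=
  _root_.Literature.NumberTheory.LFunctions.Zhang2022.Section9Statements.ded98_holds

/-! ### The two "numerical calculation shows" claims: decided by the numerics lane (row N-02) -/

/-- **`Z22:§9.u013` is TRUE**: "`c₃₃ = 3.69507 + ε/2`, `|ε| < 10⁻⁵`" — `Re c₃₃ ∈ (3.695072, 3.695073)`, `Im c₃₃ = 0`
(`c33_re_bounds`, `c33_im`, Section18Certificate), so `ε = 2(c₃₃ − 3.69507)`, `|ε| < 6·10⁻⁶`; the numerics lane's record of the
same claim is `Numerics.n02_printedC33_num_holds` (NumericsSection9, row N-02) — re-derived here from the same kernel brackets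
so that this file imports `Section9Statements` only.
[cite: Zhang2022LandauSiegel, §9 p.52, tex L2670–L2673] -/
theorem step9u013_holds : Step9u013 := by
  have him := c33_im
  have hre := c33_re_bounds
  refine ⟨((2 * (c33.re - 3.69507) : ℝ) : ℂ), ?_, ?_⟩
  · rw [Complex.norm_real, Real.norm_eq_abs, abs_lt]
    constructor <;> linarith [hre.1, hre.2]
  · have h2 : ((2 * (c33.re - 3.69507) : ℝ) : ℂ) / 2 = ((c33.re - 3.69507 : ℝ) : ℂ) := by
      push_cast; ring
    rw [h2]
    apply Complex.ext
    · simp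
    · simp [him]

/-- `Step9u013` — `_holds` alias of `step9u013_holds` above under the fact's exact name (appended
2026-08-28, D-0026 bookkeeping: the proof term is the existing theorem of this file; no statement,
definition or attribute is edited; no new named fact; the ledger's debt table listed the fact
unproved). [cite: Zhang2022LandauSiegel, §9 p.52, tex L2670–L2673] -/
theorem _root_.Literature.NumberTheory.LFunctions.Zhang2022.Section9Statements.Step9u013_holds :
    Step9u013 :=
  _root_.Literature.NumberTheory.LFunctions.Zhang2022.Section9Statements.step9u013_holds

/-- **`Z22:§9.u014` is TRUE in the `((0.5)(0.498)π)⁻¹` reading of (9.5)–(9.6)** (`c34c`): `Re c34c ∈ (−0.452605, −0.452604)`,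
`Im c34c ∈ (0.194741, 0.194742)` (`c34c_re_bounds`, `c34c_im_bounds`) give `‖c34c − (−0.4526 + 0.19474i)‖ < 7·10⁻⁶ < 10⁻⁵/√2` —
the printed digits are this reading's (numerics-lane record: `Numerics.n02_printedC34c_num_holds`, row N-02).
[cite: Zhang2022LandauSiegel, §9 p.52, tex L2674–L2676] -/
theorem step9u014c_holds : Step9u014c := by
  have hre := c34c_re_bounds
  have him := c34c_im_bounds
  set d : ℂ := c34c - (((-0.4526 : ℝ) : ℂ) + ((0.19474 : ℝ) : ℂ) * I) with hd
  have hdre : d.re = c34c.re + 0.4526 := by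
    rw [hd]; simp
  have hdim : d.im = c34c.im - 0.19474 := by
    rw [hd]; simp
  refine ⟨((Real.sqrt 2 : ℝ) : ℂ) * d, ?_, ?_⟩
  · have h1 : ‖d‖ ≤ |d.re| + |d.im| := Complex.norm_le_abs_re_add_abs_im d
    have h2 : |d.re| < 5e-6 := by
      rw [hdre, abs_lt]; constructor <;> linarith [hre.1, hre.2]
    have h3 : |d.im| < 2e-6 := by
      rw [hdim, abs_lt]; constructor <;> linarith [him.1, him.2]
    have hs : Real.sqrt 2 < 1.4143 := by
      rw [Real.sqrt_lt' (by norm_num)]; norm_num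
    have hs0 : 0 ≤ Real.sqrt 2 := Real.sqrt_nonneg 2
    rw [norm_mul, Complex.norm_real, Real.norm_eq_abs, abs_of_nonneg hs0]
    calc Real.sqrt 2 * ‖d‖ ≤ 1.4143 * (5e-6 + 2e-6) :=
          mul_le_mul hs.le (by linarith) (norm_nonneg _) (by norm_num)
      _ < 1e-5 := by norm_num
  · have hs : ((Real.sqrt 2 : ℝ) : ℂ) ≠ 0 := by
      exact_mod_cast (Real.sqrt_pos.mpr (by norm_num : (0:ℝ) < 2)).ne'
    rw [mul_div_cancel_left₀ d hs, hd]
    ring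

/-- `Step9u014c` — `_holds` alias of `step9u014c_holds` above under the fact's exact name (appended
2026-08-28, D-0026 bookkeeping: the proof term is the existing theorem of this file; no statement,
definition or attribute is edited; no new named fact; the ledger's debt table listed the fact
unproved). [cite: Zhang2022LandauSiegel, §9 p.52, tex L2674–L2676] -/
theorem _root_.Literature.NumberTheory.LFunctions.Zhang2022.Section9Statements.Step9u014c_holds :
    Step9u014c :=
  _root_.Literature.NumberTheory.LFunctions.Zhang2022.Section9Statements.step9u014c_holds

/-- **`Z22:§9.u014` FAILS in the printed-prefactor reading**: with `b₃₄, b₄₃` carrying the printed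
`((0.504)(0.498)π)⁻¹` of (9.5)–(9.6), `Re c₃₄ ∈ (−0.449013, −0.449012)` (`c34_re_bounds`), `3.6·10⁻³` from the printed `−0.4526`
(numerics-lane record: `Numerics.not_n02_printedC34_num`; tree `prefactor_95_96`). A misprint in a prefactor — (9.8) holds under
both readings (`ineq98`, `ineq98c`); NOT a statement about Theorems 1–2. [cite: Zhang2022LandauSiegel, §9 p.52, tex L2674–L2676] -/
theorem not_step9u014 : ¬ Step9u014 := by
  rintro ⟨e, he, heq⟩
  have hre : c34.re = -0.4526 + (e / ((Real.sqrt 2 : ℝ) : ℂ)).re := by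
    rw [heq]; simp
  have hs1 : (1 : ℝ) ≤ Real.sqrt 2 := by
    nlinarith [Real.sq_sqrt (by norm_num : (0:ℝ) ≤ 2), Real.sqrt_nonneg 2]
  have h1 : |(e / ((Real.sqrt 2 : ℝ) : ℂ)).re| ≤ ‖e‖ := by
    calc |(e / ((Real.sqrt 2 : ℝ) : ℂ)).re| ≤ ‖e / ((Real.sqrt 2 : ℝ) : ℂ)‖ :=
          Complex.abs_re_le_norm _
      _ = ‖e‖ / ‖((Real.sqrt 2 : ℝ) : ℂ)‖ := norm_div _ _
      _ ≤ ‖e‖ / 1 := by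
          apply div_le_div_of_nonneg_left (norm_nonneg e) one_pos
          rw [Complex.norm_real, Real.norm_eq_abs, abs_of_nonneg (Real.sqrt_nonneg 2)]
          exact hs1
      _ = ‖e‖ := div_one _
  have h2 := c34_re_bounds.1
  have h4 := le_abs_self (e / ((Real.sqrt 2 : ℝ) : ℂ)).re
  linarith

/-! ### The expansion of `S_j(𝐚₁₂,𝐚₂₂)`: an exact identity for quadratic `χ` -/

/-- **`Z22:§9.u001` DISCHARGED**: the expansion of `S_j(𝐚₁₂,𝐚₂₂)` (display after (9.2); print has `Σ_d` with
`r` free — read `Σ_dΣ_r` as in `S_j`) is an exact identity for every quadratic `χ`: `χ(drm) = χ(d)χ(r)χ(m)`,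
`χ(d)² = |χ(d)|`, `|μ(r)|χ(r)² = |μχ(r)|`, `conj χ = χ`; no (A), no largeness used.
[cite: Zhang2022LandauSiegel, §9 p.51, tex L2598–L2602] -/
theorem step9u001_holds (c' : ℝ) : Step9u001 c' := by
  refine ⟨1, fun D _ χ _ hq _ j _ => ?_⟩
  have hval : ∀ a : ZMod D, χ a = 0 ∨ χ a = 1 ∨ χ a = -1 := hq
  have hsq : ∀ a : ZMod D, χ a * χ a = (‖χ a‖ : ℂ) := by
    intro a; rcases hval a with h | h | h <;> simp [h]
  have hconj : ∀ a : ZMod D, conj (χ a) = χ a := by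
    intro a; rcases hval a with h | h | h <;> simp [h]
  have hmul3 : ∀ d r m : ℕ, χ ((d * r * m : ℕ) : ZMod D) =
      χ (d : ZMod D) * χ (r : ZMod D) * χ (m : ZMod D) := by
    intro d r m; push_cast; rw [map_mul, map_mul]
  unfold Skeleton.Sj
  refine Finset.sum_congr rfl fun d _ => Finset.sum_congr rfl fun r _ => ?_
  have hm : ∑ m ∈ Finset.Ico 1 (Skeleton.Nsupp D),
        Skeleton.a12 χ (d * r * m) / (m : ℂ) ^ (1 - Skeleton.betaJ c' D j) =
      χ (d : ZMod D) * χ (r : ZMod D) *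
        ∑ m ∈ Finset.Ico 1 (Skeleton.Nsupp D),
          χ (m : ZMod D) * (conj iota3 * Skeleton.vk3 D (d * r * m) +
            conj iota4 * Skeleton.vk2 D (d * r * m)) / (m : ℂ) ^ (1 - Skeleton.betaJ c' D j) := by
    rw [Finset.mul_sum]
    refine Finset.sum_congr rfl fun m _ => ?_
    unfold Skeleton.a12
    rw [hmul3]
    ring
  have hn : ∑ n ∈ Finset.Ico 1 (Skeleton.Nsupp D),
        Skeleton.a22 χ (d * r * n) * Skeleton.xiZero c' D j n d r / (n : ℂ) =
      χ (d : ZMod D) * χ (r : ZMod D) *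
        ∑ n ∈ Finset.Ico 1 (Skeleton.Nsupp D),
          χ (n : ZMod D) * (iota3 * conj (Skeleton.vk3 D (d * r * n)) +
            iota4 * conj (Skeleton.vk2 D (d * r * n))) * Skeleton.xiZero c' D j n d r / (n : ℂ) := by
    rw [Finset.mul_sum]
    refine Finset.sum_congr rfl fun n _ => ?_
    unfold Skeleton.a22 Skeleton.a12
    rw [hmul3]
    simp only [map_mul, map_add, Complex.conj_conj, hconj]
    ring
  rw [hm, hn]
  have hC : (‖(ArithmeticFunction.moebius r : ℂ) * χ (r : ZMod D)‖ : ℂ) =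
      ((ArithmeticFunction.moebius r).natAbs : ℂ) * (χ (r : ZMod D) * χ (r : ZMod D)) := by
    rw [hsq, norm_mul, Complex.norm_intCast]
    push_cast
    congr 1
    norm_cast
    rw [Nat.cast_natAbs, Int.cast_abs]
  rw [hC, ← hsq (d : ZMod D)]
  ring

variable (c' : ℝ) in
/-- `Step9u001` — `_holds` alias of `step9u001_holds` above under the fact's exact name, stated under the
prover's own binders as section variables (appended 2026-08-28, D-0026 bookkeeping: the proof term is the
existing theorem of this file; no statement, definition or attribute is edited; no new named fact; the
ledger's debt table listed the fact unproved). [cite: Zhang2022LandauSiegel, §9 p.51, tex L2598–L2602] -/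
theorem _root_.Literature.NumberTheory.LFunctions.Zhang2022.Section9Statements.Step9u001_holds :
    _root_.Literature.NumberTheory.LFunctions.Zhang2022.Section9Statements.Step9u001 c' :=
  _root_.Literature.NumberTheory.LFunctions.Zhang2022.Section9Statements.step9u001_holds (c' := c')

end Literature.NumberTheory.LFunctions.Zhang2022.Section9Statements

end
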